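import Summits.PneNP.PneNP.Theorems.NegLimitedAmplifiedWindowDefs
import Summits.PneNP.PneNP.Theorems.NegLimitedAmplifiedWindowWindow
import Literature.Computability.Complexity.RossmanMonotoneCliqueSparseNoiseRelative
import Mathlib
import HarnessLib

/-!
# Route NegLimited — line `amplified-window`, stub `stub_criticalWindow` (rung F-N1/p3, ROUND-11)

Registered stub (B) of the skeleton `amplified-window` on the door item
`NegLimited.NeglimitedEpsLogNegationsR` (stmt-PneNP-19860; HOME/pnp-ideate-p3/r11/amplified-window.lean
v2 sha c828757ca2bc7a67; card r11/amplified-window.md §5; ROUND-11 §B.8; referee SCORE-R11 PASS):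

  `CriticalWindowHardness`: an absolute `β > 0` (here `β = 1/64`) such that for every exponent `c`
  some FIXED clique size `k = k(c)` (here `k = 8c + 17`) is `β`-hard on average for size-`n^c`
  monotone `{∧,∨,0,1}`-circuits under an exactly balanced FKG-lattice weight on the edges of `K_n`,
  for all large `n`.

THE WEIGHT: the uniform mixture `μ⁰ = (1/T) Σ_{i<T} G(n, p_i)` of the sprinkling ladder
`p_{i+1} = p_i ⊕ n^{-3/(2K)}` (`K = 4c+8`, `k = 2K+1`, `T = ⌊n^{1/(4K)}⌋` rungs) started at the `p₀`
that makes `avg_i Pr_{p_i}[ω_k ≥ 1] = ½` exactly (`ladderBalance_holds`, IVT).  It is nonnegative and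
FKG-lattice (`ladderMix_fkg` ← `NegLimitedDoor.fkg_gnpMixture`) and exactly balanced for `CLIQUE(n,k)`.

THE BOUND: for a monotone01 circuit `C` of size `≤ n^c`, the tree's PROVED relative sparse-noise
theorem `thm1_sparse_relative` (`k' = K`, `ρ = 3/(2K)`, `δ = 1/(2K)`, `η = 1/100`) is exactly the
pointwise hypothesis of `rungStep_holds` at every rung; the balanced ladder sits in the critical window
(`ladder_window`: `λ_i ≥ 1/4`, `p_i ≤ 2b·n^{-2/(k-1)}`, `b = 4·2^k·k!`, via Markov, Paley–Zygmund and
`criticalSecondMoment_holds`), so `√(E N_k²)/λ_i ≤ 5/2`; summing the rungs (`rung_sum_bound`) against the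
exact balance and Cauchy–Schwarz gives `1/2 − 1/T − θ ≤ (5/2)√ē + ē`, whence the mean error `ē ≥ 1/64`
(`mean_error_ge_of_window`), i.e. `agreeAt μ⁰ CLIQUE C ≤ 1 − 1/64`.

References: B. Rossman, *The monotone complexity of k-clique on random graphs*, FOCS 2010 / SIAM J.
Comput. 43 (2014), Thm 1 & App. B [Rossman2010] (sparse relative form = tree `thm1_sparse_relative`);
B. Rossman, *Correlation bounds against monotone NC¹*, CCC 2015 [Rossman2015CorrelationMonotoneNC1]
(the target shape; p. 394 lists a correlation bound for `k`-CLIQUE against mP under `G(n,p)` as open —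
here the law is a critical-window MIXTURE, not one `G(n,p)`).

HONEST FRAMING: a CONSTANT-error average-case lower bound for fixed-`k` CLIQUE against polynomial-size
MONOTONE circuits under an explicit FKG-lattice law — stub B of a line whose other load-bearing stub
(A, monotone hardness amplification) is OPEN; the door item is NOT closed by this file; FRONTIER rung
F-N1 — nothing here bears on P vs NP.
-/

set_option linter.dupNamespace false -- `Summit.PneNP.PneNP.…`: summit = sub-problem name (D-0017 single-conjunct layout)

namespace Summit.PneNP.PneNP.Theorems.NegLimitedAmplifiedWindow

open Finset Filter
open Literature.Computability.Complexity
open Summit.PneNP.PneNP.Theorems.NegLimitedDoor (massAt agreeAt)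
open Summit.PneNP.PneNP.Theorems.NegLimitedDoor.AmplifiedWindowBase

/-- `exp(−y) ≤ 1/100` for `y ≥ 99` (`exp y ≥ y + 1`). -/
theorem exp_neg_le_of_le {y : ℝ} (hy : 99 ≤ y) : Real.exp (-y) ≤ 1 / 100 := by
  have h1 : y + 1 ≤ Real.exp y := Real.add_one_le_exp y
  have h2 : (100 : ℝ) ≤ Real.exp y := by linarith
  rw [Real.exp_neg, inv_eq_one_div]
  exact one_div_le_one_div_of_le (by norm_num) h2

/-- **Registered stub `stub_criticalWindow`** of the skeleton `amplified-window` (stmt-PneNP-19860):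
CONSTANT-error (`β = 1/64`) average-case hardness of `CLIQUE(n, 8c+17)` for size-`n^c` monotone
circuits under the balanced critical-window ladder mixture. -/
theorem stub_criticalWindow : CriticalWindowHardness := by
  classical
  refine ⟨1 / 64, by norm_num, fun c => ?_⟩
  -- ### parameters
  obtain ⟨K, hKdef⟩ : ∃ K : ℕ, K = 4 * (c + 2) := ⟨_, rfl⟩
  obtain ⟨k, hkdef⟩ : ∃ k : ℕ, k = 2 * K + 1 := ⟨_, rfl⟩
  have hK5 : 5 ≤ K := by omega
  have hcK : 4 * (c + 2) ≤ K := by omega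
  have hKk : K ≤ k := by omega
  have hk2 : 2 ≤ k := by omega
  have hK0 : (0 : ℝ) < K := by exact_mod_cast (show 0 < K by omega)
  have hkr : ((k : ℕ) : ℝ) - 1 = 2 * K := by rw [hkdef]; push_cast; ring
  have hexp_thr : -(2 : ℝ) / ((k : ℝ) - 1) = -(1 / (K : ℝ)) := by rw [hkr]; field_simp
  obtain ⟨ρ, hρ⟩ : ∃ ρ : ℝ, ρ = 3 / (2 * K) := ⟨_, rfl⟩
  obtain ⟨δ, hδ⟩ : ∃ δ : ℝ, δ = 1 / (2 * K) := ⟨_, rfl⟩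
  have hρ0 : 0 < ρ := by rw [hρ]; positivity
  have hδ0 : 0 < δ := by rw [hδ]; positivity
  have hρδ : ρ + δ ≤ 2 / (K : ℝ) := by rw [hρ, hδ]; apply le_of_eq; field_simp; ring
  -- the tree's relative sparse-noise theorem, `η = 1/100`
  have hthm := thm1_sparse_relative (c := c) (k := k) (k' := K) hK5 hcK hKk hρ0 hδ0 hρδ
    (by norm_num : (0 : ℝ) < 1 / 100)
  -- the density scale `b` and the second-moment constant
  obtain ⟨b, hbdef⟩ : ∃ b : ℝ, b = 4 * 2 ^ k * (k.factorial : ℝ) := ⟨_, rfl⟩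
  have hb1 : 1 ≤ b := by
    have : (1 : ℝ) ≤ 2 ^ k * (k.factorial : ℝ) :=
      one_le_mul_of_one_le_of_one_le (one_le_pow₀ (by norm_num))
        (by exact_mod_cast Nat.succ_le_of_lt (Nat.factorial_pos k))
    rw [hbdef]; nlinarith
  have hb0 : 0 < b := by linarith
  obtain ⟨K₂, hK₂0, hK₂⟩ := criticalSecondMoment_holds k hk2 (2 * b) (by linarith)
  set C := k.choose 2 with hC
  have hC1 : 1 ≤ C := Nat.succ_le_of_lt (Nat.choose_pos hk2)
  have hC0 : (0 : ℝ) < C := by exact_mod_cast hC1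
  have hC1r : (1 : ℝ) ≤ C := by exact_mod_cast hC1
  -- ### eventual side conditions
  have hev_n : ∀ᶠ n : ℕ in atTop, 2 * k ≤ n := eventually_ge_atTop _
  have hev_K₂ : ∀ᶠ n : ℕ in atTop, ⌈32 * K₂⌉₊ ≤ n := eventually_ge_atTop _
  have hev_pow : ∀ᶠ n : ℕ in atTop, max (100 : ℝ) (4 * C) ≤ (n : ℝ) ^ (1 / (4 * (K : ℝ))) :=
    ((tendsto_rpow_atTop (by positivity)).comp tendsto_natCast_atTop_atTop).eventually_ge_atTop _
  have hev_δ : ∀ᶠ n : ℕ in atTop, (99 : ℝ) ≤ (n : ℝ) ^ (δ / 2) :=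
    ((tendsto_rpow_atTop (by positivity)).comp tendsto_natCast_atTop_atTop).eventually_ge_atTop _
  have hev_thr : ∀ᶠ n : ℕ in atTop, (n : ℝ) ^ (-(2 : ℝ) / ((k : ℝ) - 1)) < 1 / b :=
    (tendsto_order.1 (tendsto_rpow_threshold hk2)).2 _ (by positivity)
  refine ⟨k, by omega, ?_⟩
  filter_upwards [hthm, hev_n, hev_K₂, hev_pow, hev_δ, hev_thr]
    with n hthm_n h2kn hK₂n hpow hδn hthrn
  -- ### fixed `n`: numerics
  have hn1 : 1 ≤ n := by omega
  have hn0 : (0 : ℝ) < n := by exact_mod_cast hn1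
  have hkn : k ≤ n := by omega
  set thr := (n : ℝ) ^ (-(2 : ℝ) / ((k : ℝ) - 1)) with hthr
  have hthr0 : 0 < thr := Real.rpow_pos_of_pos hn0 _
  have hthrK : thr = (n : ℝ) ^ (-(1 / (K : ℝ))) := by rw [hthr, hexp_thr]
  set q := (n : ℝ) ^ (-ρ) with hq
  have hq0 : 0 ≤ q := Real.rpow_nonneg hn0.le _
  have hq1 : q ≤ 1 := Real.rpow_le_one_of_one_le_of_nonpos (by exact_mod_cast hn1) (by linarith)
  set T : ℕ := ⌊(n : ℝ) ^ (1 / (4 * (K : ℝ)))⌋₊ with hT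
  have h100 : (100 : ℝ) ≤ (n : ℝ) ^ (1 / (4 * (K : ℝ))) := (le_max_left _ _).trans hpow
  have h4C : (4 : ℝ) * C ≤ (n : ℝ) ^ (1 / (4 * (K : ℝ))) := (le_max_right _ _).trans hpow
  have hT100 : 100 ≤ T := by
    rw [hT]; exact Nat.le_floor (by exact_mod_cast h100)
  have hT1 : 1 ≤ T := by omega
  have hTpos : (0 : ℝ) < T := by exact_mod_cast (show 0 < T by omega)
  -- `T q ≤ thr / (4C)`
  have hTq : (T : ℝ) * q ≤ thr / (4 * C) := by
    have hTle : (T : ℝ) ≤ (n : ℝ) ^ (1 / (4 * (K : ℝ))) := Nat.floor_le (Real.rpow_nonneg hn0.le _)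
    have hpow_pos : 0 < (n : ℝ) ^ (1 / (4 * (K : ℝ))) := Real.rpow_pos_of_pos hn0 _
    have h1 : (T : ℝ) * q ≤ (n : ℝ) ^ (1 / (4 * (K : ℝ))) * q := mul_le_mul_of_nonneg_right hTle hq0
    have h2 : (n : ℝ) ^ (1 / (4 * (K : ℝ))) * q = thr * ((n : ℝ) ^ (1 / (4 * (K : ℝ))))⁻¹ := by
      rw [hq, hthrK, ← Real.rpow_neg hn0.le, ← Real.rpow_add hn0, ← Real.rpow_add hn0, hρ]
      congr 1
      field_simp
      ring
    have h3 : ((n : ℝ) ^ (1 / (4 * (K : ℝ))))⁻¹ ≤ (4 * (C : ℝ))⁻¹ := by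
      rw [inv_le_inv₀ hpow_pos (by positivity)]
      exact h4C
    calc (T : ℝ) * q ≤ thr * ((n : ℝ) ^ (1 / (4 * (K : ℝ))))⁻¹ := h1.trans h2.le
      _ ≤ thr * (4 * (C : ℝ))⁻¹ := mul_le_mul_of_nonneg_left h3 hthr0.le
      _ = thr / (4 * C) := by rw [div_eq_mul_inv]
  -- the slack `θ = 1/100 + exp(−n^{δ/2}) ≤ 1/50`
  have hθ0 : (0 : ℝ) ≤ 1 / 100 + Real.exp (-((n : ℝ) ^ (δ / 2))) := by positivity
  have hθ : 1 / 100 + Real.exp (-((n : ℝ) ^ (δ / 2))) ≤ 1 / 50 := by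
    have := exp_neg_le_of_le hδn
    linarith
  -- the second moment at this `n`
  have hK₂' : ∀ p : ℝ, 0 ≤ p → p ≤ 1 → p ≤ 2 * b * thr →
      ∑ x, gnpWeight n p x * (cliqueCount n k x : ℝ) ^ 2 ≤
        (n.choose k : ℝ) * p ^ k.choose 2 + ((n.choose k : ℝ) * p ^ k.choose 2) ^ 2 + K₂ / n :=
    fun p hp0 hp1 hpb => hK₂ n hn1 p hp0 hp1 hpb
  have hK₂n32 : 32 * K₂ ≤ (n : ℝ) :=
    (Nat.le_ceil _).trans (by exact_mod_cast hK₂n)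
  have hK₂n1 : K₂ ≤ (n : ℝ) := by linarith
  have hbthr : b * thr ≤ 1 := by
    have := (mul_lt_mul_of_pos_left hthrn hb0).le
    rwa [mul_one_div_cancel hb0.ne'] at this
  -- ### the balanced ladder
  have hmono : Monotone (cliqueFn n k) := cliqueFn_monotone_holds n k
  have hlow : ∑ i ∈ range T,
      gnpProb n (1 - (1 - q) ^ i) (univ.filter fun x => 1 ≤ cliqueCount n k x) ≤ T / 2 := by
    have hterm : ∀ i ∈ range T,
        gnpProb n (1 - (1 - q) ^ i) (univ.filter fun x => 1 ≤ cliqueCount n k x) ≤ 1 / 2 := by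
      intro i hi
      have hri : 1 - (1 - q) ^ i = ladder 0 q i := by simp [ladder]
      rw [hri, filter_one_le_cliqueCount_eq]
      have hr0 : 0 ≤ ladder 0 q i := ladder_nonneg le_rfl zero_le_one hq0 hq1 i
      have hr1 : ladder 0 q i ≤ 1 := ladder_le_one zero_le_one hq1 i
      have hrT : ladder 0 q i ≤ thr / 4 := by
        have h := ladder_le_add_mul le_rfl zero_le_one hq0 hq1 i
        have hiT : (i : ℝ) ≤ T := by exact_mod_cast (mem_range.1 hi).le
        have h4 : thr / (4 * C) ≤ thr / 4 :=
          div_le_div_of_nonneg_left hthr0.le (by norm_num) (by linarith)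
        nlinarith
      have hthrC : (n.choose k : ℝ) * thr ^ C ≤ 1 := by
        have h := choose_mul_threshold_pow_le hk2 hn1 (zero_le_one (α := ℝ))
        rw [one_mul, one_pow] at h
        exact h
      calc gnpProb n (ladder 0 q i) (univ.filter fun x => cliqueFn n k x = true)
          ≤ (n.choose k : ℝ) * ladder 0 q i ^ C := gnpProb_clique_le_lambda hr0 hr1
        _ ≤ (n.choose k : ℝ) * (thr / 4) ^ C :=
            mul_le_mul_of_nonneg_left (pow_le_pow_left₀ hr0 hrT C) (Nat.cast_nonneg _)
        _ = (n.choose k : ℝ) * thr ^ C / 4 ^ C := by rw [div_pow]; ring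
        _ ≤ 1 / 4 ^ C := div_le_div_of_nonneg_right hthrC (by positivity)
        _ ≤ 1 / 4 := by
            apply div_le_div_of_nonneg_left zero_le_one (by norm_num)
            calc (4 : ℝ) = 4 ^ 1 := (pow_one _).symm
              _ ≤ 4 ^ C := pow_le_pow_right₀ (by norm_num) hC1
        _ ≤ 1 / 2 := by norm_num
    calc ∑ i ∈ range T, gnpProb n (1 - (1 - q) ^ i) (univ.filter fun x => 1 ≤ cliqueCount n k x)
        ≤ ∑ i ∈ range T, (1 / 2 : ℝ) := sum_le_sum hterm
      _ = T / 2 := by rw [sum_const, card_range, nsmul_eq_mul]; ring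
  obtain ⟨p₀, hp0, hp1, hbal⟩ := ladderBalance_holds n k T q hkn (by omega) hq0 hq1 hlow
  have hbal' : ∑ i ∈ range T,
      gnpProb n (ladder p₀ q i) (univ.filter fun x => cliqueFn n k x = true) = T / 2 := by
    rw [← filter_one_le_cliqueCount_eq]
    simpa only [ladder] using hbal
  -- the window
  have hwin := ladder_window hk2 h2kn hT1 hp0 hp1 hq0 hq1 (le_of_eq hbdef.symm) hbthr hTq hK₂' hK₂n1 hbal'
  -- ### the weight
  have hP : ∀ i ∈ range T, 0 ≤ ladder p₀ q i ∧ ladder p₀ q i ≤ 1 :=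
    fun i _ => ⟨ladder_nonneg hp0 hp1 hq0 hq1 i, ladder_le_one hp1 hq1 i⟩
  refine ⟨ladderMix n T (ladder p₀ q), ladderMix_nonneg hP, ladderMix_fkg hP, ?_, ?_, ?_⟩
  · -- balance, value `true`
    rw [massAt_ladderMix, hbal']
    field_simp
  · -- balance, value `false`
    rw [massAt_ladderMix]
    have hcompl : ∀ i, gnpProb n (ladder p₀ q i) (univ.filter fun x => cliqueFn n k x = false) =
        1 - gnpProb n (ladder p₀ q i) (univ.filter fun x => cliqueFn n k x = true) := by
      intro i
      rw [← gnpProb_compl]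
      congr 1
      ext x
      simp
    simp_rw [hcompl]
    rw [sum_sub_distrib, sum_const, card_range, nsmul_eq_mul, mul_one, hbal']
    field_simp
    ring
  · -- hardness
    intro D hD hDs
    have hpt : ∀ x, kSubsetProb n k (fun A => D.eval (x ⊔ cliqueVec A) = true) ≤
        (1 / 100 + Real.exp (-((n : ℝ) ^ (δ / 2)))) +
          gnpProb n q (univ.filter fun y => D.eval (x ⊔ y) = true) :=
      fun x => hthm_n D hD hDs x
    have hmean := mean_error_ge_of_window hn1 hT100 hp0 hp1 hq0 hq1 hθ0 hθ hK₂' hK₂0 hK₂n32 hwin hbal'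
      D.eval hpt
    have hS : (1 : ℝ) / T * ∑ i ∈ range T,
        (1 - gnpProb n (ladder p₀ q i) (univ.filter fun x => D.eval x ≠ cliqueFn n k x)) =
        1 - (∑ i ∈ range T,
          gnpProb n (ladder p₀ q i) (univ.filter fun x => D.eval x ≠ cliqueFn n k x)) / T := by
      rw [sum_sub_distrib, sum_const, card_range, nsmul_eq_mul, mul_one]
      field_simp
    rw [agreeAt_ladderMix, hS]
    linarith

end Summit.PneNP.PneNP.Theorems.NegLimitedAmplifiedWindow
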